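import Literature.NumberTheory.EllipticCurves.Agboola2007.RestrictedSelmerDual
import Literature.NumberTheory.EllipticCurves.GreenbergVatsal2000.NonPrimitiveDatumSelmerInvariants
import Literature.NumberTheory.EllipticCurves.IwasawaSelmerIsTorsionProofs
import HarnessLib

/-!
# Road α, crux `PrintCf2.SplitBadTwoRankOneOfFacts` (stmt-BirchSwinnertonDyer-20368), stub S3d `stub_strictDefectAtVbar_two` (v12), TRANSPORT STEP:
# when the Greenberg–Vatsal group `S_M(K_∞)` and Agboola's `𝔖_𝔮(K_∞, M)` COINCIDE, every `Λ`-dual datum of the former IS a restricted dual datum of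
# the latter with the SAME module — so `HasCharValuationAt` transfers with defect `e_δ = 0`

Cell `bsd-print-cf2`, width seat `bsd-line-cf2-p1-w6` g4 (S3d (DEF) half, LEAD rulings 01:35Z/01:48Z); `--supports stmt-BirchSwinnertonDyer-20368 --as helper`.
HONEST FRAMING: nothing here closes the crux or a registered stub; no summit statement is proved by this seat; BSD is not proved by any of this. No
definition, no named fact, no `sorry` (the restricted datum is built inside an `∃`).

S3d (v12 `Lines/rubin_value_two_lead_v12.lean`): from `Dnr : GreenbergVatsal2000.DatumDualData κ' γ' W* (bdpData W* 2 v̄) ∅` with `ch(Dnr.X) = (H')`,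
`H'(0) ≠ 0`, `v(H'(0)) = n'`, produce `D : Agboola2007.RestrictedDualData κ' W* v̄ γ'`, `n`, with `Module.Finite D.X ∧ D.HasCharValuationAt n ∧ n' = n + e_δ([d]₂)`.
In the classes where the two Selmer groups over the line are EQUAL as subgroups of `H¹(ker κ', W*)` (road α `d ≡ 7 (mod 8)`: this seat's
`LineLocallyTrivial.datumSelmer_eq_restrictedSelmerZp_of_frame`; `d ≡ 6 (mod 16)` to follow) the datum transports VERBATIM and `e_δ = 0`:

* **`exists_restrictedDualData_of_datumSelmerInfty_eq`** — generic (`K` any number field, any `p`, `κ`, `γ`, discrete `M`, place `𝔮`): if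
  `datumSelmerInfty κ M (bdpData M p 𝔮) ∅ = restrictedSelmerZp κ M 𝔮` then for every `Dnr : DatumDualData κ γ M (bdpData M p 𝔮) ∅` there is
  `D : RestrictedDualData κ M 𝔮 γ` with `D.X = Dnr.X` as a `Λ`-module (literally the same carrier, group and module structure; `toDual` precomposed with
  `AddEquiv.addSubgroupCongr`), hence: `Module.Finite`/`Module.IsTorsion` transfer and
  **`exists_restrictedDualData_hasCharValuationAt_of_datumSelmerInfty_eq`**: `ch(Dnr.X) = (H')`, `H'(0) ≠ 0`, `v(H'(0)) = n'` ⟹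
  `∃ D n, Module.Finite D.X ∧ D.HasCharValuationAt n ∧ (n' : ℤ) = n + 0` — the S3d conclusion with `e_δ = 0`.

presearch: Agboola 2007 §3 (X_𝔮 as Λ-module), Greenberg–Vatsal 2000 §2 p. 17 — held; pure transport of the tree's two dual-data structures; no fact.
beyond-print theorem: no.

References: [Agboola2007] §1 p. 2, §3 (arXiv p0008:L94–95); [GreenbergVatsal2000] §2 p. 17.
-/

noncomputable section

open scoped Classical

set_option linter.dupNamespace false
set_option autoImplicit false

open NumberField IsDedekindDomain Field
open Literature.NumberTheory.EllipticCurves Literature.NumberTheory.EllipticCurves.GreenbergSelmer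
open Literature.NumberTheory.EllipticCurves.GreenbergVatsal2000 Literature.NumberTheory.EllipticCurves.Castella2018
open Literature.NumberTheory.EllipticCurves.Agboola2007
open Literature.NumberTheory.GaloisRepresentations

namespace Summit.BirchSwinnertonDyer.BirchSwinnertonDyer.Theorems.PrintCf2.StrictDefect

variable {K : Type} [Field K] [NumberField K] {p : ℕ} [Fact p.Prime] {κ : ZpExtension K p} {γ : absoluteGaloisGroup K}
  {M : Type} [AddCommGroup M] [DistribMulAction (absoluteGaloisGroup K) M] [TopologicalSpace M] [DiscreteTopology M]
  {𝔮 : HeightOneSpectrum (𝓞 K)}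

/-- **Equal Selmer groups ⟹ the GV dual datum IS a restricted dual datum with the same module.** If
`datumSelmerInfty κ M (bdpData M p 𝔮) ∅ = restrictedSelmerZp κ M 𝔮` (as subgroups of `H¹(ker κ, M)`), then for every `Λ`-dual datum `Dnr` of the
former there is a restricted dual datum `D` of the latter whose underlying `Λ`-module is `Dnr.X` itself (so finiteness, torsion and the characteristic
ideal are literally those of `Dnr.X`). [cite: Agboola2007, §3 (arXiv p0008:L94–95)] [cite: GreenbergVatsal2000, §2 p. 17] -/
theorem exists_restrictedDualData_of_datumSelmerInfty_eq
    (h : datumSelmerInfty κ M (AcSelmer.bdpData M p 𝔮) ∅ = restrictedSelmerZp κ M 𝔮)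
    (Dnr : DatumDualData κ γ M (AcSelmer.bdpData M p 𝔮) ∅) :
    ∃ D : RestrictedDualData κ M 𝔮 γ, ∃ e : D.X ≃ₗ[IwasawaAlgebra p] Dnr.X, Function.Bijective e := by
  -- the identification of the two Selmer groups
  let ε : ↥(datumSelmerInfty κ M (AcSelmer.bdpData M p 𝔮) ∅) ≃+ ↥(restrictedSelmerZp κ M 𝔮) := AddEquiv.addSubgroupCongr h
  have hε : ∀ s : ↥(restrictedSelmerZp κ M 𝔮), ((ε.symm s : ↥(datumSelmerInfty κ M (AcSelmer.bdpData M p 𝔮) ∅)) :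
      subgroupH1 κ.kerSubgroup M) = (s : subgroupH1 κ.kerSubgroup M) := fun _ ↦ rfl
  -- precomposition with `ε.symm`
  let pre : (↥(datumSelmerInfty κ M (AcSelmer.bdpData M p 𝔮) ∅) →+ AddCircle (1 : ℚ)) →+
      (↥(restrictedSelmerZp κ M 𝔮) →+ AddCircle (1 : ℚ)) :=
    { toFun := fun f ↦ f.comp ε.symm.toAddMonoidHom
      map_zero' := by ext; rfl
      map_add' := fun f g ↦ by ext; rfl }
  have hpre : ∀ f s, pre f s = f (ε.symm s) := fun _ _ ↦ rfl
  have hpre_bij : Function.Bijective pre := by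
    constructor
    · intro f g hfg
      ext t
      have := congrArg (fun φ ↦ φ (ε t)) hfg
      simp only [hpre, AddEquiv.symm_apply_apply] at this
      exact this
    · intro g
      refine ⟨g.comp ε.toAddMonoidHom, ?_⟩
      ext s
      rw [hpre]
      change g (ε (ε.symm s)) = g s
      rw [AddEquiv.apply_symm_apply]
  let D : RestrictedDualData κ M 𝔮 γ :=
    { X := Dnr.X
      toDual := pre.comp Dnr.toDual
      bijective := hpre_bij.comp Dnr.bijective
      toDual_T_smul := fun x s ↦ by
        change pre (Dnr.toDual ((PowerSeries.X : IwasawaAlgebra p) • x)) s = pre (Dnr.toDual x) _ - pre (Dnr.toDual x) s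
        rw [hpre, hpre, hpre, Dnr.toDual_T_smul]
        exact congrArg (fun t ↦ Dnr.toDual x t - Dnr.toDual x (ε.symm s))
          (Subtype.ext rfl : (⟨conjH1 κ.kerSubgroup M γ ((ε.symm s : ↥(datumSelmerInfty κ M (AcSelmer.bdpData M p 𝔮) ∅)) :
              subgroupH1 κ.kerSubgroup M), conjH1_mem_datumSelmer κ.kerSubgroup M p _ ∅ γ (ε.symm s).2⟩ :
              ↥(datumSelmerInfty κ M (AcSelmer.bdpData M p 𝔮) ∅)) = ε.symm (conjRestricted κ M 𝔮 γ s))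
      toDual_C_smul := fun c x s k hs ↦ by
        change pre (Dnr.toDual (PowerSeries.C c • x)) s = (PadicInt.toZModPow k c).val • pre (Dnr.toDual x) s
        rw [hpre, hpre]
        refine Dnr.toDual_C_smul c x (ε.symm s) k ?_
        apply Subtype.ext
        have := congrArg (fun t : ↥(restrictedSelmerZp κ M 𝔮) ↦ (t : subgroupH1 κ.kerSubgroup M)) hs
        simpa only [AddSubmonoidClass.coe_nsmul, ZeroMemClass.coe_zero, hε] using this }
  exact ⟨D, LinearEquiv.refl _ _, (LinearEquiv.refl (IwasawaAlgebra p) Dnr.X).bijective⟩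

/-- **S3d WITH `e_δ = 0` when the two Selmer groups over the line coincide.** If `datumSelmerInfty κ M (bdpData M p 𝔮) ∅ = restrictedSelmerZp κ M 𝔮` and
the GV dual datum `Dnr` is finitely generated, torsion, with `ch(Dnr.X) = (H')`, `H'(0) ≠ 0`, `v(H'(0)) = n'`, then some restricted dual datum `D` is
finitely generated with `D.HasCharValuationAt n'` — the conclusion of `stub_strictDefectAtVbar_two` with `(n' : ℤ) = n' + 0`.
[cite: Agboola2007, §1 p. 2 (arXiv p0004:L9–13), §3] [cite: GreenbergVatsal2000, §2 p. 17] -/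
theorem exists_restrictedDualData_hasCharValuationAt_of_datumSelmerInfty_eq
    (h : datumSelmerInfty κ M (AcSelmer.bdpData M p 𝔮) ∅ = restrictedSelmerZp κ M 𝔮)
    (Dnr : DatumDualData κ γ M (AcSelmer.bdpData M p 𝔮) ∅) (n' : ℕ) (H' : IwasawaAlgebra p)
    (hfin : Module.Finite (IwasawaAlgebra p) Dnr.X) (htors : Module.IsTorsion (IwasawaAlgebra p) Dnr.X)
    (hch : Module.charIdeal (IwasawaAlgebra p) Dnr.X = Ideal.span {H'}) (hH0 : PowerSeries.constantCoeff H' ≠ 0)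
    (hn : (PowerSeries.constantCoeff H').valuation = n') :
    ∃ (D : RestrictedDualData κ M 𝔮 γ) (n : ℕ), Module.Finite (IwasawaAlgebra p) D.X ∧ D.HasCharValuationAt n ∧ (n' : ℤ) = n + 0 := by
  obtain ⟨D, e, -⟩ := exists_restrictedDualData_of_datumSelmerInfty_eq h Dnr
  haveI := hfin
  have hfinD : Module.Finite (IwasawaAlgebra p) D.X := Module.Finite.equiv e.symm
  have htorsD : Module.IsTorsion (IwasawaAlgebra p) D.X := fun x ↦ by
    obtain ⟨a, ha⟩ := @htors (e x)
    refine ⟨a, ?_⟩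
    apply e.injective
    rw [map_zero, Submonoid.smul_def, map_smul, ← Submonoid.smul_def, ha]
  have hchD : D.charIdeal = Ideal.span {H'} := by
    rw [RestrictedDualData.charIdeal, ← hch]
    exact Module.charIdeal_eq_of_linearEquiv e
  exact ⟨D, n', hfinD, RestrictedDualData.hasCharValuationAt_of_eq htorsD hchD hH0 hn, by ring⟩

end Summit.BirchSwinnertonDyer.BirchSwinnertonDyer.Theorems.PrintCf2.StrictDefect

end
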